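import Summits.QuantumFields.YangMills.Theorems.BalabanUVNodesN08AlphaEq324RowAC
import Summits.QuantumFields.YangMills.Theorems.BalabanUVNodesN08AlphaFarCurrency

/-!
# Route «BalabanUVNodes», Track-A DAG node N08 = [Balaban1985UV3] Thm 1 p. 257 ∕ Thm 2 p. 272 — THE (α)-AC ROAD'S DATA BUNDLE, A6 ∕ 13C: the lane's all-steps bundle
# `AlphaAC.AlphaDataAC` is EMPTY for records with `r₀ = 2`, the range-honest bundle `…RowAC.AlphaDataLTAC` is INHABITED at zero data for EVERY record

Cell `pub-ymgap`, seat `pub-ymgap-dag-n08-w4` gen 3 (INTENT-4; sequel of p607065).  `bears_on: R4∕N08`; filed `--supports stmt-QuantumFields-20542` (K1⁷, helper).  Two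
`def`s (the zero (63)-localisation at the AC tower, the zero range-honest AC bundle) + theorems; sorry-free; standard axioms; dag-n08-d g6's `…N08AlphaZeroData` ∕
`…N08AlphaFarCurrency` (zero series, far-currency signs, `exists_gk_gt`, `singletonDom`) consumed BY NAME.

THE LOCATED POINT (dag-n08-d g6's 13C `…AlphaFarCurrency.isEmpty_alphaData_of_r₀_eq_two`, read at the AC tower).  The binder G3D-07 «(63) as cited»
(`Binders.LogZLocalizedAsCited T k …`) carries G3D-06 for its far monomials with right side `Cfar·C63·e^{−κ𝓛}·g_k⁷(r(g_k)p(g_k))⁷` read at the TOWER's `g_k` — for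
`towerOfAC 𝔠.lane X 𝔖` as for `towerOf` this is the lattice approximation's `S.gk k` — NEGATIVE at steps with `g_k > e` when `r₀ = 2`; every lattice approximation has
such steps beyond `K` (`exists_gk_gt`).  `AlphaAC.AlphaDataAC.Λc : ∀ k` therefore has NO element for a record with `r₀ = 2`, `Cfar·C63 > 0`, whatever `X`, `𝔖`: every
∀𝔄-statement of the AC road over it — dag-n08-w1 g3's p605761 `…N08SlotOfRecordFromAlphaAC` ∕ p606479 `…MassBound` (binder `𝔄 : ∀ S, AlphaDataAC …`) — holds vacuously
THERE (satisfiable for `r₀ = 1` records), exactly as gens 3–5's non-AC closers before gen 0's range-honest re-typing.  The edition p607065∕p608282∕(INTENT-3) reads the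
range-honest `AlphaDataLTAC` (`Λc∕N45` on `k + 1 ≤ K` only), which this file INHABITS at the zero series for every record and every family member `g²ε₀ ≤ 1` (on the run
`g_k ≤ 1`, so the far currency is nonnegative — `…ZeroData.farCurrency_nonneg_of_le_one`; no `hfar`, any `r₀`).
* §1 `piecesAC_zeroRun_logZU∕logZ1` (`rfl`-level: the AC pieces' `log Z^{(k)}` letters vanish at zero data); `zeroLocalizedAC k hfar` — the zero (63)-localisation AT THE AC
  TOWER (twin of `…ZeroData.zeroLocalized`); ★ `isEmpty_alphaDataAC_of_farCurrency_neg`, ★★ `isEmpty_alphaDataAC_of_r₀_eq_two`, `not_exists_runAlphaAC_of_r₀_eq_two`.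
* §2 `zeroAlphaLTAC` — THE ZERO RANGE-HONEST AC BUNDLE; ★★ `nonempty_alphaDataLTAC_zeroRun` (EVERY record); `isEmpty_alphaDataAC_and_nonempty_alphaDataLTAC` (the contrast
  side by side); `zeroAlphaLTAC_Λc_Ψ∕_far` (`rfl`).
HONEST SCOPE.  Statements about the TYPING of the AC (α) clause's data bundle; the Prop rows (`RunAlphaEq324CoreLTAtAC` ∕ `RunAlphaAC`) are N08's object gap and are NOT
inhabited here (A6: data side only, LOCATED); nothing of [B10] asserted; not a defect of any landed theorem (p605761∕p606479 quantify over arbitrary `𝔠`); count-neutral;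
N08 NOT discharged; d = 3 lattice gauge theory on finite tori inside one finite 𝕋⁴ programme at fixed ε — R4 closes the conditional finite-𝕋⁴ rung `BalabanLadder.UV` only;
nothing about d = 4, the continuum, OS axioms, a mass gap or Clay.

References: [Balaban1985UV3] T. Bałaban, Commun. Math. Phys. 102 (1985) 255–275 — (7) p. 257, (30) p. 263, p. 264 L14–20, (63) p. 272.
-/

noncomputable section

namespace Summit.QuantumFields.YangMills.Theorems.BalabanUVNodesN08AlphaEq324RowACZero

open MeasureTheory Metric
open scoped BigOperators
open Literature.MathematicalPhysics.QuantumFieldTheory.Balaban1983to89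
open Literature.MathematicalPhysics.QuantumFieldTheory.Balaban1983to89.B10
open Literature.MathematicalPhysics.QuantumFieldTheory.Balaban1983to89.TreeLengthTorus (tsys TDom)
open Literature.MathematicalPhysics.QuantumFieldTheory.Balaban1985CMP102
open Literature.MathematicalPhysics.QuantumFieldTheory.Balaban1985CMP102.Setting
open Literature.MathematicalPhysics.QuantumFieldTheory.Balaban1985CMP102.Binders (LogZLocalizedAsCited FarTermsDecayAsCited ChartAnalyticityAsCited)
open Literature.MathematicalPhysics.QuantumFieldTheory.Balaban1985CMP102.BindersNewborn (NewbornTerms45AsCited)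
open Summit.QuantumFields.Balaban3D.Carriers
open Summit.QuantumFields.Balaban3D.Proofs
open Summit.QuantumFields.Balaban3D.Proofs.ScalesArithmetic
open Summit.QuantumFields.Balaban3D.Proofs.Inputs
open Summit.QuantumFields.Balaban3D.Proofs.Primitives
open Summit.QuantumFields.Balaban3D.Proofs.Representation33 (jet26 jet26_apply_zero)
open Summit.QuantumFields.Balaban3D.Proofs.GroupModelLieC (lieC)
open Summit.QuantumFields.Balaban3D.Proofs.UVStability3DInputs (adjAct)
open Summit.QuantumFields.Balaban3D.Proofs.StandardAC
open Summit.QuantumFields.Balaban3D.Proofs.InputsAC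
open Summit.QuantumFields.Balaban3D.Proofs.AlphaAC
open Summit.QuantumFields.YangMills.Theorems.BalabanUVNodesN08AlphaZeroData
open Summit.QuantumFields.YangMills.Theorems.BalabanUVNodesN08AlphaFarCurrency
open Summit.QuantumFields.YangMills.Theorems.BalabanUVNodesN08AlphaEq324RowAC

variable {L : ℕ}

/-! ## §1 The zero (63)-localisation at the AC tower; `AlphaDataAC` is empty for `r₀ = 2` records -/
section Localized

variable {S : Scales L} {G : Type} [GaugeGroup G] [MeasurableSpace G] [HaarData G] (𝔊 : GroupModel G) (𝔠 : AlphaConsts L 𝔊.N)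
  (X : ExternalInputsAC S G)

/-- `log Z^{(k)}(B(Λ_{k+1}), U_{k+1})` of the lane's AC pieces vanishes at zero data. [folklore] -/
@[simp] theorem piecesAC_zeroRun_logZU (k : ℕ) (h : Hist S.P (k + 1)) (U : GaugeField S.P (k + 1) G) :
    (piecesAC 𝔠.lane X (zeroRun 𝔊 𝔠) k).logZU h U = 0 :=
  zeroSeries_logZU (S := S) (G := G) (V := ↥(lieC 𝔊)) (N := nblkOf S 𝔠.lane.carrier k) h U

/-- `log Z^{(k)}(B(Λ_{k+1}), 1)` of the lane's AC pieces vanishes at zero data. [folklore] -/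
@[simp] theorem piecesAC_zeroRun_logZ1 (k : ℕ) (h : Hist S.P (k + 1)) :
    (piecesAC 𝔠.lane X (zeroRun 𝔊 𝔠) k).logZ1 h = 0 :=
  zeroSeries_logZ1 (S := S) (G := G) (V := ↥(lieC 𝔊)) (N := nblkOf S 𝔠.lane.carrier k) h

/-- **THE ZERO (63)-LOCALISATION AT THE AC TOWER** of step `k` (GAP binder G3D-07 at zero data, read at `towerOfAC 𝔠.lane X (zeroRun 𝔊 𝔠)`): localized pieces `Ψ ≡ 0`,
far monomials `0`; the telescope `log Z^{(k)}(·, U_{k+1}) − log Z^{(k)}(·, 1) = 0 − 0` is the empty expansion, G3D-01 holds for the zero function at the record's radius and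
amplitude, (26) is `rfl`, and G3D-06 holds iff its right side is nonnegative (`hfar`; automatic when `g_k ≤ 1`) — dag-n08-d g6's `…ZeroData.zeroLocalized`, verbatim at the
AC tower (whose `g_k`, `b₀`, `p₀` are the lattice approximation's ∕ the record's, definitionally). [folklore] -/
def zeroLocalizedAC (k : ℕ) (hfar : 0 ≤ 𝔠.Cfar * (𝔠.C63 * (S.gk k ^ 7 * (rFun 𝔠.r₀ (S.gk k) * pFun 𝔠.b₀ 𝔠.p₀ (S.gk k)) ^ 7))) :
    LogZLocalizedAsCited (towerOfAC 𝔠.lane X (zeroRun 𝔊 𝔠)) k ((zeroRun 𝔊 𝔠) k).E (adjAct 𝔊 (P := S.P) k) 𝔠.ρ 𝔠.r₀ 𝔠.Cfar 𝔠.C63 𝔠.κ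
      (piecesAC 𝔠.lane X (zeroRun 𝔊 𝔠) k).logZU (piecesAC 𝔠.lane X (zeroRun 𝔊 𝔠) k).logZ1 ((zeroRun 𝔊 𝔠) k).Bcfg
      (fun h => Finset.univ.filter fun Y : (tsys 3 (nblkOf S 𝔠.lane.carrier k)).Dom =>
        Y.1 ⊆ ΩblkOf 𝔠.lane.carrier.M₁ (rcolOf S 𝔠.lane.carrier) (nblkOf S 𝔠.lane.carrier k) h) where
  Ψ := fun _ _ => 0
  expandDiff := fun h U => by simp
  chart := fun Y => ⟨𝔠.ρ_pos, differentiableOn_const _, fun z _ => by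
    rw [norm_zero]; exact mul_nonneg 𝔠.C63_nonneg (Real.exp_pos _).le⟩
  inv26 := fun _ _ _ _ _ => rfl
  far := fun _ _ _ => 0
  far_le := fun Y h U => by
    rw [abs_zero]
    show 0 ≤ 𝔠.Cfar * (𝔠.C63 * Real.exp (-(𝔠.κ * (tsys 3 (nblkOf S 𝔠.lane.carrier k)).dj Y)) *
      (S.gk k ^ 7 * (rFun 𝔠.r₀ (S.gk k) * pFun 𝔠.b₀ 𝔠.p₀ (S.gk k)) ^ 7))
    have : 𝔠.Cfar * (𝔠.C63 * Real.exp (-(𝔠.κ * (tsys 3 (nblkOf S 𝔠.lane.carrier k)).dj Y)) *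
        (S.gk k ^ 7 * (rFun 𝔠.r₀ (S.gk k) * pFun 𝔠.b₀ 𝔠.p₀ (S.gk k)) ^ 7)) =
        Real.exp (-(𝔠.κ * (tsys 3 (nblkOf S 𝔠.lane.carrier k)).dj Y)) *
          (𝔠.Cfar * (𝔠.C63 * (S.gk k ^ 7 * (rFun 𝔠.r₀ (S.gk k) * pFun 𝔠.b₀ 𝔠.p₀ (S.gk k)) ^ 7))) := by ring
    rw [this]
    exact mul_nonneg (Real.exp_pos _).le hfar

variable (𝔖 : ∀ k, StepSeries S G ↥(lieC 𝔊) (nblkOf S 𝔠.lane.carrier k) k)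

/-- ★ **NEGATIVE FAR CURRENCY AT ANY STEP EMPTIES THE AC (α) AUXILIARY DATA** (AC twin of `…AlphaFarCurrency.isEmpty_alphaData_of_farCurrency_neg`): if the record's far and
(63) amplitudes are positive and at some step `k` the currency `g_k⁷·(r(g_k)·p(g_k))⁷` is negative, then NO `AlphaDataAC 𝔊 𝔠 X 𝔖` exists — its field `(Λc k).far_le` at the
one-block domain, the trivial history and the unit field would bound an absolute value by a negative number. [cite: Balaban1985UV3, p.264 L14–20 + p.271 L6–8 (G3D-06 as typed, read at every k)] -/
theorem isEmpty_alphaDataAC_of_farCurrency_neg (hCfar : 0 < 𝔠.Cfar) (hC63 : 0 < 𝔠.C63) {k : ℕ}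
    (hneg : S.gk k ^ 7 * (rFun 𝔠.r₀ (S.gk k) * pFun 𝔠.b₀ 𝔠.p₀ (S.gk k)) ^ 7 < 0) :
    IsEmpty (AlphaDataAC 𝔊 𝔠 X 𝔖) := by
  refine ⟨fun 𝔄 => ?_⟩
  have h := (𝔄.Λc k).far_le (singletonDom (nblkOf S 𝔠.lane.carrier k)) (Hist.triv S.P (k + 1)) (fun _ => 1)
  have hexp : 0 < Real.exp (-(𝔠.κ * (tsys 3 (nblkOf S 𝔠.lane.carrier k)).dj (singletonDom (nblkOf S 𝔠.lane.carrier k)))) :=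
    Real.exp_pos _
  have hlt : 𝔠.Cfar * (𝔠.C63 * Real.exp (-(𝔠.κ * (tsys 3 (nblkOf S 𝔠.lane.carrier k)).dj (singletonDom (nblkOf S 𝔠.lane.carrier k)))) *
      ((towerOfAC 𝔠.lane X 𝔖).g k ^ 7 * (rFun 𝔠.r₀ ((towerOfAC 𝔠.lane X 𝔖).g k) *
        pFun (towerOfAC 𝔠.lane X 𝔖).b₀ (towerOfAC 𝔠.lane X 𝔖).p₀ ((towerOfAC 𝔠.lane X 𝔖).g k)) ^ 7)) < 0 := by
    show 𝔠.Cfar * (𝔠.C63 * Real.exp (-(𝔠.κ * (tsys 3 (nblkOf S 𝔠.lane.carrier k)).dj (singletonDom (nblkOf S 𝔠.lane.carrier k)))) *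
      (S.gk k ^ 7 * (rFun 𝔠.r₀ (S.gk k) * pFun 𝔠.b₀ 𝔠.p₀ (S.gk k)) ^ 7)) < 0
    exact mul_neg_of_pos_of_neg hCfar (mul_neg_of_pos_of_neg (mul_pos hC63 hexp) hneg)
  exact absurd (lt_of_le_of_lt (abs_nonneg _) (lt_of_le_of_lt h hlt)) (lt_irrefl _)

/-- ★★ **FOR A CONSTANTS RECORD WITH `r₀ = 2` AND POSITIVE FAR ∕ (63) AMPLITUDES THE AC (α) AUXILIARY DATA DO NOT EXIST AT ANY LATTICE APPROXIMATION**: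
`IsEmpty (AlphaDataAC 𝔊 𝔠 X 𝔖)` for every `S`, `X`, `𝔖` — some step has `g_k > e` (`exists_gk_gt`), there the currency is negative (`farCurrency_neg_of_r₀_eq_two`).  LOCATED
typing looseness of the AC road (the run never reads that step): every `∀ 𝔄 : AlphaDataAC …` statement — p605761, p606479 — is vacuous for such records and satisfiable for
`r₀ = 1` ones; the range-honest `AlphaDataLTAC` of p607065 is inhabited for all (§2). [cite: Balaban1985UV3, (7) p.257 + p.264 L14–20] -/
theorem isEmpty_alphaDataAC_of_r₀_eq_two (hCfar : 0 < 𝔠.Cfar) (hC63 : 0 < 𝔠.C63) (hr : 𝔠.r₀ = 2) :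
    IsEmpty (AlphaDataAC 𝔊 𝔠 X 𝔖) := by
  obtain ⟨k, hk⟩ := exists_gk_gt S (Real.exp 1)
  exact isEmpty_alphaDataAC_of_farCurrency_neg 𝔊 𝔠 X 𝔖 hCfar hC63 (farCurrency_neg_of_r₀_eq_two 𝔠 hr hk)

/-- Consequently, for such a record the AC (α) clause `RunAlphaAC 𝔊 𝔠 X 𝔖 𝔄` has NO instance to speak about: no pin `∃ 𝔄, RunAlphaAC … 𝔄 ∧ …` can be met and every
`∀ 𝔄, RunAlphaAC … 𝔄 → …` holds vacuously. [cite: Balaban1985UV3, (41) p.266 (bookkeeping over the typed clause)] -/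
theorem not_exists_runAlphaAC_of_r₀_eq_two (hCfar : 0 < 𝔠.Cfar) (hC63 : 0 < 𝔠.C63) (hr : 𝔠.r₀ = 2) :
    ¬ ∃ 𝔄 : AlphaDataAC 𝔊 𝔠 X 𝔖, RunAlphaAC 𝔊 𝔠 X 𝔖 𝔄 := by
  rintro ⟨𝔄, -⟩
  exact (isEmpty_alphaDataAC_of_r₀_eq_two 𝔊 𝔠 X 𝔖 hCfar hC63 hr).false 𝔄

end Localized

/-! ## §2 The zero range-honest AC bundle: `AlphaDataLTAC` is inhabited for every record -/
section Zero

variable {S : Scales L} {G : Type} [GaugeGroup G] [MeasurableSpace G] [HaarData G] (𝔊 : GroupModel G) (𝔠 : AlphaConsts L 𝔊.N)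
  (X : ExternalInputsAC S G)

/-- **THE ZERO RANGE-HONEST AC BUNDLE** at the zero series, on a family member `g²ε₀ ≤ 1`: the zero (63)-localisation at the AC tower at every RUN step `k < K` (its G3D-06
sign input AUTOMATIC there: `g_k ≤ 1`, `farCurrency_nonneg_of_le_one`), G3D-08 with the record's `C45` (the jet of the zero piece vanishes), `cP ≡ 0`, zero G3D-02 constants.
No `hfar`, any `r₀` (twin of gen 0's `…RowRangeZero.zeroAlphaLT`). [folklore] -/
def zeroAlphaLTAC (hle : S.g ^ 2 * S.ε₀ ≤ 1) : AlphaDataLTAC 𝔊 𝔠 X (zeroRun 𝔊 𝔠) where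
  Λc k hk := zeroLocalizedAC 𝔊 𝔠 X k (farCurrency_nonneg_of_le_one 𝔊 𝔠 (gk_le_one S hle k (by omega)))
  N45 k hk :=
    { C45_nonneg := 𝔠.C45_nonneg
      jet45 := fun Y h U => by
        have h0 : (∑ n ∈ Finset.Ico 2 7, ((n.factorial : ℂ)⁻¹ •
            iteratedFDeriv ℂ n ((zeroLocalizedAC 𝔊 𝔠 X k
              (farCurrency_nonneg_of_le_one 𝔊 𝔠 (gk_le_one S hle k (by omega)))).Ψ Y) 0
              fun _ => ((zeroRun 𝔊 𝔠) k).Bcfg Y h U)) = 0 := by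
          show jet26 (fun _ : ((zeroRun 𝔊 𝔠) k).E => (0 : ℂ)) (0 : ((zeroRun 𝔊 𝔠) k).E) = 0
          exact jet26_apply_zero _
        rw [h0]
        show |(0 : ℂ).re - 0| ≤ _
        rw [Complex.zero_re, sub_zero, abs_zero]
        exact mul_nonneg (mul_nonneg 𝔠.C45_nonneg (sq_nonneg _)) (mul_nonneg 𝔠.C63_nonneg (Real.exp_pos _).le) }
  cP := fun _ => 0
  C₂₃ := fun _ => 0
  c₂₃ := fun _ => 0
  M₂₃ := fun _ => 0
  δ₀ := fun _ => 0

/-- ★★ **THE RANGE-HONEST AC BUNDLE IS INHABITED FOR EVERY RECORD** at the zero series of every family member — ANY `r₀`, any amplitudes `Cfar, C63`: the data side of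
the edition's binder `𝔄 : AlphaDataLTAC …` (p607065 ∕ p608282) is never vacuous. [cite: Balaban1985UV3, (7) p.257 + (63) p.272 (bookkeeping over the typed bundle)] -/
theorem nonempty_alphaDataLTAC_zeroRun (hle : S.g ^ 2 * S.ε₀ ≤ 1) : Nonempty (AlphaDataLTAC 𝔊 𝔠 X (zeroRun 𝔊 𝔠)) :=
  ⟨zeroAlphaLTAC 𝔊 𝔠 X hle⟩

/-- **CONTRAST, side by side** (13C at the AC tower, resolved by the range-honest typing): for a record with `r₀ = 2` and `Cfar, C63 > 0` the lane's AC bundle `AlphaDataAC`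
at the zero series is EMPTY while the range-honest AC bundle is NOT. [cite: Balaban1985UV3, (7) p.257 + p.264 L14–20 (bookkeeping)] -/
theorem isEmpty_alphaDataAC_and_nonempty_alphaDataLTAC (hCfar : 0 < 𝔠.Cfar) (hC63 : 0 < 𝔠.C63) (hr : 𝔠.r₀ = 2) (hle : S.g ^ 2 * S.ε₀ ≤ 1) :
    IsEmpty (AlphaDataAC 𝔊 𝔠 X (zeroRun 𝔊 𝔠)) ∧ Nonempty (AlphaDataLTAC 𝔊 𝔠 X (zeroRun 𝔊 𝔠)) :=
  ⟨isEmpty_alphaDataAC_of_r₀_eq_two 𝔊 𝔠 X (zeroRun 𝔊 𝔠) hCfar hC63 hr, nonempty_alphaDataLTAC_zeroRun 𝔊 𝔠 X hle⟩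

/-- Field of the zero range-honest AC localisation (`rfl`). [folklore] -/
@[simp] theorem zeroAlphaLTAC_Λc_Ψ (hle : S.g ^ 2 * S.ε₀ ≤ 1) (k : ℕ) (hk : k + 1 ≤ S.K) (Y : (tsys 3 (nblkOf S 𝔠.lane.carrier k)).Dom)
    (b : ((zeroRun 𝔊 𝔠) k).E) : ((zeroAlphaLTAC 𝔊 𝔠 X hle).Λc k hk).Ψ Y b = 0 := rfl

/-- Field of the zero range-honest AC localisation (`rfl`). [folklore] -/
@[simp] theorem zeroAlphaLTAC_Λc_far (hle : S.g ^ 2 * S.ε₀ ≤ 1) (k : ℕ) (hk : k + 1 ≤ S.K) (Y : (tsys 3 (nblkOf S 𝔠.lane.carrier k)).Dom)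
    (h : Hist S.P (k + 1)) (U : GaugeField S.P (k + 1) G) : ((zeroAlphaLTAC 𝔊 𝔠 X hle).Λc k hk).far Y h U = 0 := rfl

/-- **On the `≤`-family of the edition's END theorems (`g²ε₀ ≤ (min γ₀ 1)²`) the hypothesis `g²ε₀ ≤ 1` of `zeroAlphaLTAC` holds**, so the range-honest AC bundle is inhabited on
every member the ENDs of `…RowACEnd` quantify over. [cite: Balaban1985UV3, (7) p.257 (bookkeeping)] -/
theorem nonempty_alphaDataLTAC_zeroRun_of_le (hle : S.g ^ 2 * S.ε₀ ≤ (min 𝔠.gamma0 1) ^ 2) : Nonempty (AlphaDataLTAC 𝔊 𝔠 X (zeroRun 𝔊 𝔠)) :=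
  nonempty_alphaDataLTAC_zeroRun 𝔊 𝔠 X (hle.trans (by
    have h1 : min 𝔠.gamma0 1 ≤ 1 := min_le_right _ _
    have h0 : 0 ≤ min 𝔠.gamma0 1 := le_min 𝔠.gamma0_pos.le zero_le_one
    nlinarith))

end Zero

end Summit.QuantumFields.YangMills.Theorems.BalabanUVNodesN08AlphaEq324RowACZero

end
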